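import Summits.RiemannHypothesis.RiemannHypothesis.Theses.WeilSemilocal
import Summits.RiemannHypothesis.RiemannHypothesis.Theorems.SemilocalClassLaw
import Summits.RiemannHypothesis.RiemannHypothesis.Theorems.WeilSemilocalAssembly
import Summits.RiemannHypothesis.RiemannHypothesis.Theorems.WeilSemilocalSemilocalRowsToOneFiftySeven
import Summits.RiemannHypothesis.RiemannHypothesis.Theorems.WeilSemilocalWallsToTenThousand
import Summits.RiemannHypothesis.RiemannHypothesis.Theorems.WeilSemilocalWallsSixtyKGapSplit
import Summits.RiemannHypothesis.RiemannHypothesis.Theorems.WeilSemilocalWallsSixtyKTwin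
import Summits.RiemannHypothesis.RiemannHypothesis.Theorems.WeilSemilocalWallsSixtyKNonTwin
import Summits.RiemannHypothesis.RiemannHypothesis.Theorems.WeilSemilocalSemilocalWallsFromSixtyThousand
import HarnessLib

/-!
# Route `WeilSemilocal` — CAPSTONE: the leaf `SemilocalClassLaw.SemilocalClassLawAll` (LADDER-RH rung W-P(P2); RH-FREE, kernel)

The deciding theorem `Theses.WeilSemilocal.closes` of `route-RiemannHypothesis-WeilSemilocal` applied to the closing theorems of its six
binders: 19095 `Assembly` (`WeilSemilocalRoute.assembly_proof`), 19397 `SemilocalClassLawHead` (the kernel head `q < 80`,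
`SemilocalClassLaw.semilocalClassLawBelow_eighty` — VERBATIM the unfolding used by the item's closer `semilocalClassLawHead_proof`, taken
from `SemilocalClassLaw` directly so that this capstone imports only hub-built modules), 19396 `SemilocalRowsToOneFiftySeven`
(`semilocalRowsToOneFiftySeven_proof`, cc-s2-10), 19395 `SemilocalWallsToTenThousand` (`semilocalWallsToTenThousand_proof`, cc-s2-1 g23,
= glue ∘ tier-2 twins ∘ tier-1 non-twins), 19096 `SemilocalWallsToSixtyThousand` (closed via its gap-class split: `wallsSixtyKGapSplit_proof`
applied to `wallsSixtyKTwin_proof` (dodger-p2 / handoff-prove-2) and `wallsSixtyKNonTwin_proof` (cc-s2-1)), 19097 `SemilocalWallsFromSixtyThousand`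
(`semilocalWallsFromSixtyThousand_proof`).  Conclusion = C-I(a) at EVERY prime: for every prime `q` and every prime `q' > q`,
`a*(S_q) = weilSemilocalThreshold (Nat.primesBelow q) < (log q')/2` — UPPER clauses of TRUNCATED Weil forms (cell `rh-explicit`);
nothing here bears on the truth of RH.
-/

set_option linter.dupNamespace false  -- the mandated namespace repeats `RiemannHypothesis`
set_option autoImplicit false

namespace Summit.RiemannHypothesis.RiemannHypothesis.Theorems.WeilSemilocalRoute

/-- **CAPSTONE of `route-RiemannHypothesis-WeilSemilocal`** — the leaf `SemilocalClassLawAll` (C-I(a) at every prime `q`: `a*(S_q) < (log q')/2`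
for every prime `q' > q`), by the route's deciding theorem `Theses.WeilSemilocal.closes` over the six binders' closing theorems.
[this cell; RH-FREE; thresholds as in Yoshida 1992 Prop. 6] -/
theorem semilocalClassLawAll_proof :
    Summit.RiemannHypothesis.RiemannHypothesis.Theorems.SemilocalClassLaw.SemilocalClassLawAll := by
  have hH : Summit.RiemannHypothesis.RiemannHypothesis.Theses.WeilSemilocal.SemilocalClassLawHead := by
    unfold Theses.WeilSemilocal.SemilocalClassLawHead
    intro q hq h80
    exact SemilocalClassLaw.semilocalClassLawBelow_eighty q hq h80
  exact Theses.WeilSemilocal.closes assembly_proof hH semilocalRowsToOneFiftySeven_proof semilocalWallsToTenThousand_proof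
    (wallsSixtyKGapSplit_proof wallsSixtyKTwin_proof wallsSixtyKNonTwin_proof) semilocalWallsFromSixtyThousand_proof

end Summit.RiemannHypothesis.RiemannHypothesis.Theorems.WeilSemilocalRoute
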